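import Summits.CriticalPhenomena.PercolationContinuityZ3.Theorems.PercNearOneGluingNoHeavyLowerTailSahiGridPatternReduce

/-!
# `NoHeavyLowerTail` (crux stmt-CriticalPhenomena-4575), Sahi programme: **THEOREM R′ — DELETING A MINIMAL TOP POINT THAT LIES IN THE OTHER TWO TOPS NEVER
# INCREASES THE UPPER-STEP SLACK (every dimension); with THEOREM R: COMB-M⁺ for ANTICHAIN increments, and reduction to doubly-irreducible pairs**

Support file (seat `prim-ineq-gen-4`, generation 14; `--supports stmt-CriticalPhenomena-4575`).  Pure proofs, no definitions, no `sorry`, standard axioms.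
Vocabulary and machinery of `…SahiGridPattern{Reduce,WForm,YProfile,Faces,TwoLayerTop,TwoSetsTop,Kleitman,Harris}`.

THE MATHEMATICS.  Upper-step triple `Au, Bu, Cu ⊆ [3]^{n+1}` (level-`1` slice = level-`2` slice), `Bu, Cu` up-sets, slices `A⁰, A²`, `B⁰ ⊆ B²`, `C⁰ ⊆ C²`; the
SLACK is `Ψ(Au) := sStarD Au Bu Cu − 2·sStarD(A²,B²,C²)` (cube `2^{n+1}(c₂ − c₃)`).  For a point `w ∈ A² ∩ B² ∩ C²` put `Au′ := Au ∖ {(w,1),(w,2)}` (the TOP slice of `A`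
loses `w`; the bottom slice is unchanged; `Au′` is again upper-step, and an up-set when `w` is minimal in `A²` and `(w,0) ∉ Au`).  The W-form (`…WForm`, slot `A`) gives the
exact change (`slack_erase_top_eq`):
  `Ψ(Au) − Ψ(Au′) = 2·yProfile B² C² w + 2·Σ_q (B²−B⁰)(q)·td(q,w)·(1 − C²(q̄)) + 2·Σ_q (C²−C⁰)(q)·td(q,w)·(1 − B²(q̄)) + 2·Σ_q (B²C² − B⁰C⁰)(q)·td(w,q)`
(`q̄ = thirdPt q w`; every term `≥ 0`: the y-profile of `(B²,C²)` at the meet point `w` (`yProfile_nonneg_of_mem`), two fibre counts, one monotone pair count).  Hence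
**THEOREM R′** (`slack_erase_top_le`): `sStarD Au′ Bu Cu − 2·sStarD(A²∖{w},B²,C²) ≤ sStarD Au Bu Cu − 2·sStarD(A²,B²,C²)`.
CONSEQUENCES (with THEOREM R of `…Reduce`, memo FINDING-W-FORM-g14.md (R′)): (i) COMB-M⁺ reduces to DOUBLY-IRREDUCIBLE nested pairs (`max(a) ⊆ B∩C` and
`min(A′) ∩ a ∩ B′C′ = ∅` in every slot; 1.0 % of the `m = 4` cells, 0.04 % of random `m = 5` nested triples); (ii) **ANTICHAIN INCREMENTS**: if each increment
`a = A′∖A`, `b`, `c` is an antichain then COMB-M⁺ holds given `PatternPos n` (a point of an antichain increment is maximal in it and, if it lies in `B∩C ⊆ B′C′`, minimal in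
`A′`; so R or R′ always applies and the pair reduces to `β = τ`, where the slack is `2·sStarD τ ≥ 0`).
HONEST LABEL: COMB-M⁺ in general, `PatternPos d` (`d ≥ 4`), Sahi's `C₃` and Kahn's conjecture remain OPEN; nothing here asserts them. [this work]
-/

namespace Summit.CriticalPhenomena.PercolationContinuityZ3.Theorems.SahiGridPattern

open Finset SahiGrid3
open scoped BigOperators

variable {n : ℕ}

/-- Splitting a pair count whose FIRST indicator is `insert w S`. [this work] -/
theorem sum_pair_insert_first {S : Finset (Pd n)} {w : Pd n} (hw : w ∉ S) (f g : Pd n → ℤ) :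
    (∑ p, ∑ q, ind (insert w S) p * f q * g q * (if TotDist p q = true then (1:ℤ) else 0)) =
      (∑ p, ∑ q, ind S p * f q * g q * (if TotDist p q = true then (1:ℤ) else 0)) + (∑ q, f q * g q * (if TotDist w q = true then (1:ℤ) else 0)) := by
  have e : ∀ p, (∑ q, ind (insert w S) p * f q * g q * (if TotDist p q = true then (1:ℤ) else 0)) = (∑ q, ind S p * f q * g q * (if TotDist p q = true then (1:ℤ) else 0)) + (if p = w then (∑ q, f q * g q * (if TotDist p q = true then (1:ℤ) else 0)) else 0) := by
    intro p; rw [ind_insert_of_not_mem hw p]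
    by_cases h : p = w
    · rw [if_pos h, if_pos h, ← Finset.sum_add_distrib]; exact Finset.sum_congr rfl fun q _ => by ring
    · rw [if_neg h, if_neg h]; simp only [add_zero]
  rw [Finset.sum_congr rfl fun p _ => e p, Finset.sum_add_distrib, Finset.sum_ite_eq' univ w, if_pos (mem_univ w)]

/-- Splitting a Latin count whose THIRD-point indicator is `insert w S`. [this work] -/
theorem sum_latin_insert_third {S : Finset (Pd n)} {w : Pd n} (hw : w ∉ S) (f g : Pd n → ℤ) :
    (∑ q, ∑ r, f q * g r * ind (insert w S) (thirdPt q r) * (if TotDist q r = true then (1:ℤ) else 0)) =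
      (∑ q, ∑ r, f q * g r * ind S (thirdPt q r) * (if TotDist q r = true then (1:ℤ) else 0)) + (∑ q, f q * g (thirdPt q w) * (if TotDist q w = true then (1:ℤ) else 0)) := by
  rw [← Finset.sum_add_distrib]
  refine Finset.sum_congr rfl fun q _ => ?_
  have hiff : ∀ r, thirdPt q r = w ↔ r = thirdPt q w := fun r =>
    ⟨fun h => by rw [← h, thirdPt_thirdPt], fun h => by rw [h, thirdPt_thirdPt]⟩
  have e : ∀ r, f q * g r * ind (insert w S) (thirdPt q r) * (if TotDist q r = true then (1:ℤ) else 0) =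
      f q * g r * ind S (thirdPt q r) * (if TotDist q r = true then (1:ℤ) else 0) + (if r = thirdPt q w then f q * g r * (if TotDist q r = true then (1:ℤ) else 0) else 0) := by
    intro r; rw [ind_insert_of_not_mem hw (thirdPt q r)]
    by_cases h : r = thirdPt q w
    · rw [if_pos ((hiff r).2 h), if_pos h]; ring
    · rw [if_neg (fun h' => h ((hiff r).1 h')), if_neg h]; ring
  rw [Finset.sum_congr rfl fun r _ => e r, Finset.sum_add_distrib, Finset.sum_ite_eq' univ (thirdPt q w), if_pos (mem_univ _), totDist_thirdPt_right]

/-- Re-indexing a fibre sum at `w` along `q ↦ thirdPt q w`. [this work] -/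
theorem sum_thirdPt_reindex_sub (w : Pd n) (X Y : Finset (Pd n)) :
    (∑ q, (ind X (thirdPt q w) - ind Y (thirdPt q w)) * (if TotDist q w = true then (1:ℤ) else 0)) = ∑ q, (ind X q - ind Y q) * (if TotDist q w = true then (1:ℤ) else 0) := by
  rw [← sum_comp_thirdPt w (fun q => (ind X q - ind Y q) * (if TotDist q w = true then (1:ℤ) else 0))]
  refine Finset.sum_congr rfl fun q _ => ?_
  show (ind X (thirdPt q w) - ind Y (thirdPt q w)) * (if TotDist q w = true then (1:ℤ) else 0) = (ind X (thirdPt w q) - ind Y (thirdPt w q)) * (if TotDist (thirdPt w q) w = true then (1:ℤ) else 0)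
  rw [thirdPt_comm q w, totDist_symm (thirdPt w q) w, totDist_thirdPt_right w q, totDist_symm w q]

/-- **THE EFFECT OF DELETING ONE TOP POINT** (every `n`; identity): for an upper-step triple `Au, Bu, Cu` and `w ∈ A²`, with `Au′ = Au ∖ {(w,1),(w,2)}` and `S = A²∖w`,
`[sStarD Au Bu Cu − 2·sStarD(A²,B²,C²)] − [sStarD Au′ Bu Cu − 2·sStarD(S,B²,C²)]
  = 2·sStarD({w},B²,C²) + 2·ΔΘ_B + 2·ΔΘ_C + 2·Δg_A` with the three differences written in fibre counts at `w` (`q̄ = thirdPt q w`). [this work] -/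
theorem slack_erase_top_eq (Au Bu Cu : Finset (Pd (n + 1))) (w : Pd n)
    (hAu : ∀ q : Pd n, ind Au (Fin.snoc q 1 : Pd (n + 1)) = ind Au (Fin.snoc q 2 : Pd (n + 1)))
    (hBu : ∀ q : Pd n, ind Bu (Fin.snoc q 1 : Pd (n + 1)) = ind Bu (Fin.snoc q 2 : Pd (n + 1)))
    (hCu : ∀ q : Pd n, ind Cu (Fin.snoc q 1 : Pd (n + 1)) = ind Cu (Fin.snoc q 2 : Pd (n + 1)))
    (hw2 : (Fin.snoc w 2 : Pd (n + 1)) ∈ Au) :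
    (sStarD Au Bu Cu - 2 * sStarD (univ.filter fun q : Pd n => (Fin.snoc q 2 : Pd (n + 1)) ∈ Au) (univ.filter fun q : Pd n => (Fin.snoc q 2 : Pd (n + 1)) ∈ Bu) (univ.filter fun q : Pd n => (Fin.snoc q 2 : Pd (n + 1)) ∈ Cu))
      - (sStarD ((Au.erase (Fin.snoc w 1 : Pd (n + 1))).erase (Fin.snoc w 2 : Pd (n + 1))) Bu Cu - 2 * sStarD (((univ.filter fun q : Pd n => (Fin.snoc q 2 : Pd (n + 1)) ∈ Au)).erase w) (univ.filter fun q : Pd n => (Fin.snoc q 2 : Pd (n + 1)) ∈ Bu) (univ.filter fun q : Pd n => (Fin.snoc q 2 : Pd (n + 1)) ∈ Cu)) =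
      2 * sStarD ({w} : Finset (Pd n)) (univ.filter fun q : Pd n => (Fin.snoc q 2 : Pd (n + 1)) ∈ Bu) (univ.filter fun q : Pd n => (Fin.snoc q 2 : Pd (n + 1)) ∈ Cu)
      + 2 * (ind (univ.filter fun q : Pd n => (Fin.snoc q 2 : Pd (n + 1)) ∈ Cu) w * (∑ p, ind (univ.filter fun q : Pd n => (Fin.snoc q 2 : Pd (n + 1)) ∈ Bu) p * (if TotDist p w = true then (1:ℤ) else 0)) - ind (univ.filter fun q : Pd n => (Fin.snoc q 2 : Pd (n + 1)) ∈ Cu) w * (∑ p, ind (univ.filter fun q : Pd n => (Fin.snoc q 0 : Pd (n + 1)) ∈ Bu) p * (if TotDist p w = true then (1:ℤ) else 0))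
             - (∑ q, ind (univ.filter fun q : Pd n => (Fin.snoc q 2 : Pd (n + 1)) ∈ Bu) q * ind (univ.filter fun q : Pd n => (Fin.snoc q 2 : Pd (n + 1)) ∈ Cu) (thirdPt q w) * (if TotDist q w = true then (1:ℤ) else 0)) + (∑ q, ind (univ.filter fun q : Pd n => (Fin.snoc q 0 : Pd (n + 1)) ∈ Bu) q * ind (univ.filter fun q : Pd n => (Fin.snoc q 2 : Pd (n + 1)) ∈ Cu) (thirdPt q w) * (if TotDist q w = true then (1:ℤ) else 0)))
      + 2 * (ind (univ.filter fun q : Pd n => (Fin.snoc q 2 : Pd (n + 1)) ∈ Bu) w * (∑ p, ind (univ.filter fun q : Pd n => (Fin.snoc q 2 : Pd (n + 1)) ∈ Cu) p * (if TotDist p w = true then (1:ℤ) else 0)) - ind (univ.filter fun q : Pd n => (Fin.snoc q 2 : Pd (n + 1)) ∈ Bu) w * (∑ p, ind (univ.filter fun q : Pd n => (Fin.snoc q 0 : Pd (n + 1)) ∈ Cu) p * (if TotDist p w = true then (1:ℤ) else 0))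
             - (∑ q, ind (univ.filter fun q : Pd n => (Fin.snoc q 2 : Pd (n + 1)) ∈ Bu) q * ind (univ.filter fun q : Pd n => (Fin.snoc q 2 : Pd (n + 1)) ∈ Cu) (thirdPt q w) * (if TotDist q w = true then (1:ℤ) else 0)) + (∑ q, ind (univ.filter fun q : Pd n => (Fin.snoc q 2 : Pd (n + 1)) ∈ Bu) q * ind (univ.filter fun q : Pd n => (Fin.snoc q 0 : Pd (n + 1)) ∈ Cu) (thirdPt q w) * (if TotDist q w = true then (1:ℤ) else 0)))
      + 2 * ((∑ q, ind (univ.filter fun q : Pd n => (Fin.snoc q 2 : Pd (n + 1)) ∈ Bu) q * ind (univ.filter fun q : Pd n => (Fin.snoc q 2 : Pd (n + 1)) ∈ Cu) q * (if TotDist w q = true then (1:ℤ) else 0)) - (∑ q, ind (univ.filter fun q : Pd n => (Fin.snoc q 0 : Pd (n + 1)) ∈ Bu) q * ind (univ.filter fun q : Pd n => (Fin.snoc q 0 : Pd (n + 1)) ∈ Cu) q * (if TotDist w q = true then (1:ℤ) else 0))) := by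
  have hne : ∀ (q : Pd n) (i j : Fin 3), i ≠ j → (Fin.snoc q i : Pd (n + 1)) ≠ Fin.snoc w j := fun q i j hij h => by
    have := congrFun h (Fin.last n); simp only [Fin.snoc_last] at this; exact hij this
  have hinj : ∀ (q : Pd n) (i : Fin 3), (Fin.snoc q i : Pd (n + 1)) = Fin.snoc w i → q = w := fun q i h => by
    funext a; have := congrFun h (Fin.castSucc a); simpa [Fin.snoc_castSucc] using this
  have hwS : w ∉ (((univ.filter fun q : Pd n => (Fin.snoc q 2 : Pd (n + 1)) ∈ Au)).erase w) := fun h => (Finset.mem_erase.1 h).1 rfl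
  have hw2f : w ∈ (univ.filter fun q : Pd n => (Fin.snoc q 2 : Pd (n + 1)) ∈ Au) := mem_filter.2 ⟨mem_univ _, hw2⟩
  have eA2 : (univ.filter fun q : Pd n => (Fin.snoc q 2 : Pd (n + 1)) ∈ Au) = (insert w (((univ.filter fun q : Pd n => (Fin.snoc q 2 : Pd (n + 1)) ∈ Au)).erase w)) := (Finset.insert_erase hw2f).symm
  have e2 : (univ.filter fun q : Pd n => (Fin.snoc q 2 : Pd (n + 1)) ∈ ((Au.erase (Fin.snoc w 1 : Pd (n + 1))).erase (Fin.snoc w 2 : Pd (n + 1)))) = (((univ.filter fun q : Pd n => (Fin.snoc q 2 : Pd (n + 1)) ∈ Au)).erase w) := by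
    ext q
    simp only [mem_filter, mem_univ, true_and, Finset.mem_erase]
    constructor
    · rintro ⟨h1, _, h3⟩; exact ⟨fun h => h1 (by rw [h]), h3⟩
    · rintro ⟨h1, h2⟩; exact ⟨fun h => h1 (hinj q 2 h), hne q 2 1 (by decide), h2⟩
  have e0 : (univ.filter fun q : Pd n => (Fin.snoc q 0 : Pd (n + 1)) ∈ ((Au.erase (Fin.snoc w 1 : Pd (n + 1))).erase (Fin.snoc w 2 : Pd (n + 1)))) = (univ.filter fun q : Pd n => (Fin.snoc q 0 : Pd (n + 1)) ∈ Au) := by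
    ext q
    simp only [mem_filter, mem_univ, true_and, Finset.mem_erase]
    constructor
    · rintro ⟨_, _, h3⟩; exact h3
    · intro h; exact ⟨hne q 0 2 (by decide), hne q 0 1 (by decide), h⟩
  have hAu' : ∀ q : Pd n, ind ((Au.erase (Fin.snoc w 1 : Pd (n + 1))).erase (Fin.snoc w 2 : Pd (n + 1))) (Fin.snoc q 1 : Pd (n + 1)) = ind ((Au.erase (Fin.snoc w 1 : Pd (n + 1))).erase (Fin.snoc w 2 : Pd (n + 1))) (Fin.snoc q 2 : Pd (n + 1)) := by
    intro q; have h := hAu q; unfold ind at h ⊢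
    by_cases hq : q = w
    · subst hq
      rw [if_neg (fun h' => (Finset.mem_erase.1 (Finset.mem_erase.1 h').2).1 rfl), if_neg (fun h' => (Finset.mem_erase.1 h').1 rfl)]
    · have h1 : (Fin.snoc q 1 : Pd (n + 1)) ≠ Fin.snoc w 1 := fun h' => hq (hinj q 1 h')
      have h2' : (Fin.snoc q 2 : Pd (n + 1)) ≠ Fin.snoc w 2 := fun h' => hq (hinj q 2 h')
      have m1 : ((Fin.snoc q 1 : Pd (n + 1)) ∈ ((Au.erase (Fin.snoc w 1 : Pd (n + 1))).erase (Fin.snoc w 2 : Pd (n + 1)))) ↔ ((Fin.snoc q 1 : Pd (n + 1)) ∈ Au) := by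
        simp only [Finset.mem_erase, hne q 1 2 (by decide), h1, ne_eq, not_false_eq_true, true_and]
      have m2 : ((Fin.snoc q 2 : Pd (n + 1)) ∈ ((Au.erase (Fin.snoc w 1 : Pd (n + 1))).erase (Fin.snoc w 2 : Pd (n + 1)))) ↔ ((Fin.snoc q 2 : Pd (n + 1)) ∈ Au) := by
        simp only [Finset.mem_erase, h2', hne q 2 1 (by decide), ne_eq, not_false_eq_true, true_and]
      simp only [m1, m2]; exact h
  have eW := sStarD_upperStep_wForm Au Bu Cu hAu hBu hCu
  have eW' := sStarD_upperStep_wForm ((Au.erase (Fin.snoc w 1 : Pd (n + 1))).erase (Fin.snoc w 2 : Pd (n + 1))) Bu Cu hAu' hBu hCu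
  rw [e0, e2] at eW'
  rw [eA2] at eW
  have eTop : sStarD (univ.filter fun q : Pd n => (Fin.snoc q 2 : Pd (n + 1)) ∈ Au) (univ.filter fun q : Pd n => (Fin.snoc q 2 : Pd (n + 1)) ∈ Bu) (univ.filter fun q : Pd n => (Fin.snoc q 2 : Pd (n + 1)) ∈ Cu) = sStarD ({w} : Finset (Pd n)) (univ.filter fun q : Pd n => (Fin.snoc q 2 : Pd (n + 1)) ∈ Bu) (univ.filter fun q : Pd n => (Fin.snoc q 2 : Pd (n + 1)) ∈ Cu) + sStarD (((univ.filter fun q : Pd n => (Fin.snoc q 2 : Pd (n + 1)) ∈ Au)).erase w) (univ.filter fun q : Pd n => (Fin.snoc q 2 : Pd (n + 1)) ∈ Bu) (univ.filter fun q : Pd n => (Fin.snoc q 2 : Pd (n + 1)) ∈ Cu) := by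
    rw [← sStarD_insert_first hwS, Finset.insert_erase hw2f]
  rw [eTop]
  have s0 := sStarD_insert_first hwS (univ.filter fun q : Pd n => (Fin.snoc q 2 : Pd (n + 1)) ∈ Bu) (univ.filter fun q : Pd n => (Fin.snoc q 2 : Pd (n + 1)) ∈ Cu)
  have s1 := sum_pair_insert_first hwS (ind (univ.filter fun q : Pd n => (Fin.snoc q 2 : Pd (n + 1)) ∈ Bu)) (ind (univ.filter fun q : Pd n => (Fin.snoc q 2 : Pd (n + 1)) ∈ Cu))
  have s2 := sum_pair_insert_first hwS (ind (univ.filter fun q : Pd n => (Fin.snoc q 0 : Pd (n + 1)) ∈ Bu)) (ind (univ.filter fun q : Pd n => (Fin.snoc q 0 : Pd (n + 1)) ∈ Cu))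
  have s3 := sum_latin_insert_third hwS (ind (univ.filter fun q : Pd n => (Fin.snoc q 2 : Pd (n + 1)) ∈ Bu)) (ind (univ.filter fun q : Pd n => (Fin.snoc q 2 : Pd (n + 1)) ∈ Cu))
  have s4 := sum_pair_insert_mid hwS (ind (univ.filter fun q : Pd n => (Fin.snoc q 2 : Pd (n + 1)) ∈ Bu)) (ind (univ.filter fun q : Pd n => (Fin.snoc q 2 : Pd (n + 1)) ∈ Cu))
  have s5 := sum_pair_insert_mid hwS (ind (univ.filter fun q : Pd n => (Fin.snoc q 0 : Pd (n + 1)) ∈ Bu)) (ind (univ.filter fun q : Pd n => (Fin.snoc q 2 : Pd (n + 1)) ∈ Cu))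
  have s6 := sum_latin_insert_third hwS (ind (univ.filter fun q : Pd n => (Fin.snoc q 0 : Pd (n + 1)) ∈ Bu)) (ind (univ.filter fun q : Pd n => (Fin.snoc q 2 : Pd (n + 1)) ∈ Cu))
  have s7 := sum_pair_insert_mid hwS (ind (univ.filter fun q : Pd n => (Fin.snoc q 2 : Pd (n + 1)) ∈ Cu)) (ind (univ.filter fun q : Pd n => (Fin.snoc q 2 : Pd (n + 1)) ∈ Bu))
  have s8 := sum_pair_insert_mid hwS (ind (univ.filter fun q : Pd n => (Fin.snoc q 0 : Pd (n + 1)) ∈ Cu)) (ind (univ.filter fun q : Pd n => (Fin.snoc q 2 : Pd (n + 1)) ∈ Bu))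
  have s9 := sum_latin_insert_third hwS (ind (univ.filter fun q : Pd n => (Fin.snoc q 2 : Pd (n + 1)) ∈ Bu)) (ind (univ.filter fun q : Pd n => (Fin.snoc q 0 : Pd (n + 1)) ∈ Cu))
  rw [s0, s1, s2, s3, s4, s5, s6, s7, s8, s9] at eW
  linarith [eW, eW']

/-- **THEOREM R′** (every `n`): for an upper-step triple `Au, Bu, Cu ⊆ [3]^{n+1}` with `Bu, Cu` up-sets and a point `w` of the top slice `A²` lying in BOTH other top
slices, deleting `w` from the top of `A` (`Au′ = Au ∖ {(w,1),(w,2)}`) does not increase the upper-step slack: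
`sStarD Au′ Bu Cu − 2·sStarD(A²∖w,B²,C²) ≤ sStarD Au Bu Cu − 2·sStarD(A²,B²,C²)`.  (When `w` is minimal in `A²` and `(w,0) ∉ Au`, `Au′` is again an up-set with the
same bottom slice, so COMB-M⁺ for the pair `(A ⊆ A′)` follows from COMB-M⁺ for `(A ⊆ A′∖w)`.) [this work] -/
theorem slack_erase_top_le (Au Bu Cu : Finset (Pd (n + 1))) (w : Pd n)
    (hB : IsUpperSet (Bu : Set (Pd (n + 1)))) (hC : IsUpperSet (Cu : Set (Pd (n + 1))))
    (hAu : ∀ q : Pd n, ind Au (Fin.snoc q 1 : Pd (n + 1)) = ind Au (Fin.snoc q 2 : Pd (n + 1)))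
    (hBu : ∀ q : Pd n, ind Bu (Fin.snoc q 1 : Pd (n + 1)) = ind Bu (Fin.snoc q 2 : Pd (n + 1)))
    (hCu : ∀ q : Pd n, ind Cu (Fin.snoc q 1 : Pd (n + 1)) = ind Cu (Fin.snoc q 2 : Pd (n + 1)))
    (hw2 : (Fin.snoc w 2 : Pd (n + 1)) ∈ Au) (hwB : (Fin.snoc w 2 : Pd (n + 1)) ∈ Bu) (hwC : (Fin.snoc w 2 : Pd (n + 1)) ∈ Cu) :
    sStarD ((Au.erase (Fin.snoc w 1 : Pd (n + 1))).erase (Fin.snoc w 2 : Pd (n + 1))) Bu Cu - 2 * sStarD (((univ.filter fun q : Pd n => (Fin.snoc q 2 : Pd (n + 1)) ∈ Au)).erase w) (univ.filter fun q : Pd n => (Fin.snoc q 2 : Pd (n + 1)) ∈ Bu) (univ.filter fun q : Pd n => (Fin.snoc q 2 : Pd (n + 1)) ∈ Cu) ≤ sStarD Au Bu Cu - 2 * sStarD (univ.filter fun q : Pd n => (Fin.snoc q 2 : Pd (n + 1)) ∈ Au) (univ.filter fun q : Pd n => (Fin.snoc q 2 : Pd (n + 1)) ∈ Bu) (univ.filter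 fun q : Pd n => (Fin.snoc q 2 : Pd (n + 1)) ∈ Cu) := by
  have e := slack_erase_top_eq Au Bu Cu w hAu hBu hCu hw2
  have nB : ∀ p, ind (univ.filter fun q : Pd n => (Fin.snoc q 0 : Pd (n + 1)) ∈ Bu) p ≤ ind (univ.filter fun q : Pd n => (Fin.snoc q 2 : Pd (n + 1)) ∈ Bu) p := fun p => by
    rw [ind_filter_snoc, ind_filter_snoc]; exact ind_snoc_mono hB p (by decide)
  have nC : ∀ p, ind (univ.filter fun q : Pd n => (Fin.snoc q 0 : Pd (n + 1)) ∈ Cu) p ≤ ind (univ.filter fun q : Pd n => (Fin.snoc q 2 : Pd (n + 1)) ∈ Cu) p := fun p => by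
    rw [ind_filter_snoc, ind_filter_snoc]; exact ind_snoc_mono hC p (by decide)
  have iB2 : ind (univ.filter fun q : Pd n => (Fin.snoc q 2 : Pd (n + 1)) ∈ Bu) w = 1 := by rw [ind_filter_snoc]; unfold ind; rw [if_pos hwB]
  have iC2 : ind (univ.filter fun q : Pd n => (Fin.snoc q 2 : Pd (n + 1)) ∈ Cu) w = 1 := by rw [ind_filter_snoc]; unfold ind; rw [if_pos hwC]
  have le1 : ∀ (X : Finset (Pd n)) (q : Pd n), ind X q ≤ 1 := fun X q => by unfold ind; split_ifs <;> norm_num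
  -- (0) the y-profile of (B²,C²) at the meet point w
  have P0 : 0 ≤ sStarD ({w} : Finset (Pd n)) (univ.filter fun q : Pd n => (Fin.snoc q 2 : Pd (n + 1)) ∈ Bu) (univ.filter fun q : Pd n => (Fin.snoc q 2 : Pd (n + 1)) ∈ Cu) := by
    rw [sStarD_swap12, sStarD_swap23, sStarD_eq_sum_yProfile, Finset.sum_singleton]
    exact yProfile_nonneg_of_mem (mem_inter.2 ⟨mem_filter.2 ⟨mem_univ _, hwB⟩, mem_filter.2 ⟨mem_univ _, hwC⟩⟩)
  -- (1) ΔΘ_B ≥ 0 termwise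
  have P1 : 0 ≤ ind (univ.filter fun q : Pd n => (Fin.snoc q 2 : Pd (n + 1)) ∈ Cu) w * (∑ p, ind (univ.filter fun q : Pd n => (Fin.snoc q 2 : Pd (n + 1)) ∈ Bu) p * (if TotDist p w = true then (1:ℤ) else 0)) - ind (univ.filter fun q : Pd n => (Fin.snoc q 2 : Pd (n + 1)) ∈ Cu) w * (∑ p, ind (univ.filter fun q : Pd n => (Fin.snoc q 0 : Pd (n + 1)) ∈ Bu) p * (if TotDist p w = true then (1:ℤ) else 0))
             - (∑ q, ind (univ.filter fun q : Pd n => (Fin.snoc q 2 : Pd (n + 1)) ∈ Bu) q * ind (univ.filter fun q : Pd n => (Fin.snoc q 2 : Pd (n + 1)) ∈ Cu) (thirdPt q w) * (if TotDist q w = true then (1:ℤ) else 0)) + (∑ q, ind (univ.filter fun q : Pd n => (Fin.snoc q 0 : Pd (n + 1)) ∈ Bu) q * ind (univ.filter fun q : Pd n => (Fin.snoc q 2 : Pd (n + 1)) ∈ Cu) (thirdPt q w) * (if TotDist q w = true then (1:ℤ) else 0)) := by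
    rw [iC2, one_mul, one_mul, ← Finset.sum_sub_distrib, ← Finset.sum_sub_distrib, ← Finset.sum_add_distrib]
    refine Finset.sum_nonneg fun q _ => ?_
    have h1 := nB q
    have h2 := le1 (univ.filter fun q : Pd n => (Fin.snoc q 2 : Pd (n + 1)) ∈ Cu) (thirdPt q w)
    have hd : 0 ≤ (if TotDist q w = true then (1:ℤ) else 0) := by split_ifs <;> norm_num
    have : ind (univ.filter fun q : Pd n => (Fin.snoc q 2 : Pd (n + 1)) ∈ Bu) q * (if TotDist q w = true then (1:ℤ) else 0) - ind (univ.filter fun q : Pd n => (Fin.snoc q 0 : Pd (n + 1)) ∈ Bu) q * (if TotDist q w = true then (1:ℤ) else 0) - ind (univ.filter fun q : Pd n => (Fin.snoc q 2 : Pd (n + 1)) ∈ Bu) q * ind (univ.filter fun q : Pd n => (Fin.snoc q 2 : Pd (n + 1)) ∈ Cu) (thirdPt q w) * (if TotDist q w = true then (1:ℤ) else 0) + ind (univ.filter fun q : Pd n => (Fin.snoc q 0 : Pd (n + 1)) ∈ Bu) q * ind (univ.filter fun q : Pd n => (Fin.snoc q 2 : Pd (n + 1)) ∈ Cu) (thirdPt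 q w) * (if TotDist q w = true then (1:ℤ) else 0)
        = (ind (univ.filter fun q : Pd n => (Fin.snoc q 2 : Pd (n + 1)) ∈ Bu) q - ind (univ.filter fun q : Pd n => (Fin.snoc q 0 : Pd (n + 1)) ∈ Bu) q) * ((1 - ind (univ.filter fun q : Pd n => (Fin.snoc q 2 : Pd (n + 1)) ∈ Cu) (thirdPt q w)) * (if TotDist q w = true then (1:ℤ) else 0)) := by ring
    rw [this]; exact mul_nonneg (by linarith) (mul_nonneg (by linarith) hd)
  -- (2) ΔΘ_C ≥ 0 after re-indexing the Λ-part
  have P2 : 0 ≤ ind (univ.filter fun q : Pd n => (Fin.snoc q 2 : Pd (n + 1)) ∈ Bu) w * (∑ p, ind (univ.filter fun q : Pd n => (Fin.snoc q 2 : Pd (n + 1)) ∈ Cu) p * (if TotDist p w = true then (1:ℤ) else 0)) - ind (univ.filter fun q : Pd n => (Fin.snoc q 2 : Pd (n + 1)) ∈ Bu) w * (∑ p, ind (univ.filter fun q : Pd n => (Fin.snoc q 0 : Pd (n + 1)) ∈ Cu) p * (if TotDist p w = true then (1:ℤ) else 0))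
             - (∑ q, ind (univ.filter fun q : Pd n => (Fin.snoc q 2 : Pd (n + 1)) ∈ Bu) q * ind (univ.filter fun q : Pd n => (Fin.snoc q 2 : Pd (n + 1)) ∈ Cu) (thirdPt q w) * (if TotDist q w = true then (1:ℤ) else 0)) + (∑ q, ind (univ.filter fun q : Pd n => (Fin.snoc q 2 : Pd (n + 1)) ∈ Bu) q * ind (univ.filter fun q : Pd n => (Fin.snoc q 0 : Pd (n + 1)) ∈ Cu) (thirdPt q w) * (if TotDist q w = true then (1:ℤ) else 0)) := by
    have re := sum_thirdPt_reindex_sub w (univ.filter fun q : Pd n => (Fin.snoc q 2 : Pd (n + 1)) ∈ Cu) (univ.filter fun q : Pd n => (Fin.snoc q 0 : Pd (n + 1)) ∈ Cu)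
    have step : (∑ q, ind (univ.filter fun q : Pd n => (Fin.snoc q 2 : Pd (n + 1)) ∈ Bu) q * ind (univ.filter fun q : Pd n => (Fin.snoc q 2 : Pd (n + 1)) ∈ Cu) (thirdPt q w) * (if TotDist q w = true then (1:ℤ) else 0)) - (∑ q, ind (univ.filter fun q : Pd n => (Fin.snoc q 2 : Pd (n + 1)) ∈ Bu) q * ind (univ.filter fun q : Pd n => (Fin.snoc q 0 : Pd (n + 1)) ∈ Cu) (thirdPt q w) * (if TotDist q w = true then (1:ℤ) else 0))
        ≤ ∑ q, (ind (univ.filter fun q : Pd n => (Fin.snoc q 2 : Pd (n + 1)) ∈ Cu) (thirdPt q w) - ind (univ.filter fun q : Pd n => (Fin.snoc q 0 : Pd (n + 1)) ∈ Cu) (thirdPt q w)) * (if TotDist q w = true then (1:ℤ) else 0) := by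
      rw [← Finset.sum_sub_distrib]
      refine Finset.sum_le_sum fun q _ => ?_
      have h1 := nC (thirdPt q w)
      have h2 := le1 (univ.filter fun q : Pd n => (Fin.snoc q 2 : Pd (n + 1)) ∈ Bu) q
      have hd : 0 ≤ (if TotDist q w = true then (1:ℤ) else 0) := by split_ifs <;> norm_num
      have : (ind (univ.filter fun q : Pd n => (Fin.snoc q 2 : Pd (n + 1)) ∈ Cu) (thirdPt q w) - ind (univ.filter fun q : Pd n => (Fin.snoc q 0 : Pd (n + 1)) ∈ Cu) (thirdPt q w)) * (if TotDist q w = true then (1:ℤ) else 0) - (ind (univ.filter fun q : Pd n => (Fin.snoc q 2 : Pd (n + 1)) ∈ Bu) q * ind (univ.filter fun q : Pd n => (Fin.snoc q 2 : Pd (n + 1)) ∈ Cu) (thirdPt q w) * (if TotDist q w = true then (1:ℤ) else 0) - ind (univ.filter fun q : Pd n => (Fin.snoc q 2 : Pd (n + 1)) ∈ Bu) q * ind (univ.filter fun q : Pd n => (Fin.snoc q 0 : Pd (n + 1)) ∈ Cu) (thirdPt q w) * (if TotDist q w = true then (1:ℤ) else 0))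
          = (1 - ind (univ.filter fun q : Pd n => (Fin.snoc q 2 : Pd (n + 1)) ∈ Bu) q) * ((ind (univ.filter fun q : Pd n => (Fin.snoc q 2 : Pd (n + 1)) ∈ Cu) (thirdPt q w) - ind (univ.filter fun q : Pd n => (Fin.snoc q 0 : Pd (n + 1)) ∈ Cu) (thirdPt q w)) * (if TotDist q w = true then (1:ℤ) else 0)) := by ring
      nlinarith [mul_nonneg (show (0:ℤ) ≤ 1 - ind (univ.filter fun q : Pd n => (Fin.snoc q 2 : Pd (n + 1)) ∈ Bu) q by linarith) (mul_nonneg (show (0:ℤ) ≤ ind (univ.filter fun q : Pd n => (Fin.snoc q 2 : Pd (n + 1)) ∈ Cu) (thirdPt q w) - ind (univ.filter fun q : Pd n => (Fin.snoc q 0 : Pd (n + 1)) ∈ Cu) (thirdPt q w) by linarith) hd)]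
    have e3 : ind (univ.filter fun q : Pd n => (Fin.snoc q 2 : Pd (n + 1)) ∈ Bu) w * (∑ p, ind (univ.filter fun q : Pd n => (Fin.snoc q 2 : Pd (n + 1)) ∈ Cu) p * (if TotDist p w = true then (1:ℤ) else 0)) - ind (univ.filter fun q : Pd n => (Fin.snoc q 2 : Pd (n + 1)) ∈ Bu) w * (∑ p, ind (univ.filter fun q : Pd n => (Fin.snoc q 0 : Pd (n + 1)) ∈ Cu) p * (if TotDist p w = true then (1:ℤ) else 0)) = ∑ q, (ind (univ.filter fun q : Pd n => (Fin.snoc q 2 : Pd (n + 1)) ∈ Cu) q - ind (univ.filter fun q : Pd n => (Fin.snoc q 0 : Pd (n + 1)) ∈ Cu) q) * (if TotDist q w = true then (1:ℤ) else 0) := by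
      rw [iB2, one_mul, one_mul, ← Finset.sum_sub_distrib]
      exact Finset.sum_congr rfl fun q _ => by ring
    linarith
  -- (3) Δg_A ≥ 0 termwise
  have P3 : 0 ≤ (∑ q, ind (univ.filter fun q : Pd n => (Fin.snoc q 2 : Pd (n + 1)) ∈ Bu) q * ind (univ.filter fun q : Pd n => (Fin.snoc q 2 : Pd (n + 1)) ∈ Cu) q * (if TotDist w q = true then (1:ℤ) else 0)) - (∑ q, ind (univ.filter fun q : Pd n => (Fin.snoc q 0 : Pd (n + 1)) ∈ Bu) q * ind (univ.filter fun q : Pd n => (Fin.snoc q 0 : Pd (n + 1)) ∈ Cu) q * (if TotDist w q = true then (1:ℤ) else 0)) := by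
    rw [← Finset.sum_sub_distrib]
    refine Finset.sum_nonneg fun q _ => ?_
    have h1 := nB q; have h2 := nC q
    have hb : 0 ≤ ind (univ.filter fun q : Pd n => (Fin.snoc q 0 : Pd (n + 1)) ∈ Bu) q := ind_nonneg' _ _
    have hc : 0 ≤ ind (univ.filter fun q : Pd n => (Fin.snoc q 0 : Pd (n + 1)) ∈ Cu) q := ind_nonneg' _ _
    have hd : 0 ≤ (if TotDist w q = true then (1:ℤ) else 0) := by split_ifs <;> norm_num
    have : ind (univ.filter fun q : Pd n => (Fin.snoc q 2 : Pd (n + 1)) ∈ Bu) q * ind (univ.filter fun q : Pd n => (Fin.snoc q 2 : Pd (n + 1)) ∈ Cu) q * (if TotDist w q = true then (1:ℤ) else 0) - ind (univ.filter fun q : Pd n => (Fin.snoc q 0 : Pd (n + 1)) ∈ Bu) q * ind (univ.filter fun q : Pd n => (Fin.snoc q 0 : Pd (n + 1)) ∈ Cu) q * (if TotDist w q = true then (1:ℤ) else 0) = (ind (univ.filter fun q : Pd n => (Fin.snoc q 2 : Pd (n + 1)) ∈ Bu) q * ind (univ.filter fun q : Pd n => (Fin.snoc q 2 : Pd (n +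 1)) ∈ Cu) q - ind (univ.filter fun q : Pd n => (Fin.snoc q 0 : Pd (n + 1)) ∈ Bu) q * ind (univ.filter fun q : Pd n => (Fin.snoc q 0 : Pd (n + 1)) ∈ Cu) q) * (if TotDist w q = true then (1:ℤ) else 0) := by ring
    rw [this]
    exact mul_nonneg (by nlinarith [mul_le_mul h1 h2 hc (le_trans hb h1)]) hd
  linarith [e, P0, P1, P2, P3]

end Summit.CriticalPhenomena.PercolationContinuityZ3.Theorems.SahiGridPattern
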